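import Summits.BirchSwinnertonDyer.Rank1Residual.Additive.RamifiedSevenGenusNormedFamilyFields
import Summits.BirchSwinnertonDyer.Rank1Residual.Additive.RamifiedSevenGenusNumberFieldColumn
import Literature.NumberTheory.ComplexMultiplication.EllipticUnits.KroneckerLimitFormulaGenusCharacters
import Literature.NumberTheory.QuadraticFields.DiscriminantOfSqrt
import HarnessLib

set_option autoImplicit false

/-!
# `𝒞₇` genus road (crux `EllipticUnitValueSevenOfGZK`, K7r), the (5)-unit programme (SUMMON GENUS-UNIT-A5), File B1:
# the PIN'S FIELD BOOKKEEPING (`𝔣 = (√−7)·(D)`, `d_K = −7`, the aligned roots `ζₙ ∈ K(7^{n+1}𝔣)`) and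
# KRONECKER'S LIMIT FORMULA AT THE GENUS CHARACTERS ON THE PIN DATA — the Kato-side level-`n` identity — and the K-side
# regrouping along `θu n = e(N_{K(7^{n+1}𝔣)/Mₙ} zₙ)` (memo S0, S3, S5 (a); THEOREMS ONLY)

Cell bsd-cm, seat bsd-cm-k-ty1 g26 (literature-prover); ruled typing memo `pub/bsd-cm/bsd-cm-k-ty1/g26/G45-typing-memo.md`
(c225f82434dc25c5, pen D941), File A = `EllipticUnits/KroneckerLimitFormulaGenusCharacters.lean` (p786166).  This file opens
the binders of the value pin `IsNormedEllipticUnitFamily F θu` (`RamifiedSevenGenusKatoShapes.lean` §1: a degree-2 field `K`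
with `s² = −7`, `ι : K → ℂ`, `e : K̄ → ℚ̄`, the conductor `𝔣` pinned by `N𝔣 = 7·d²` and `𝔣 ∣ (7D)`, an admissible twist `𝔞`,
level representatives `z n` of Kato's `_𝔞z_{7^{n+1}𝔣}`) and DISCHARGES, from those pins alone, every side condition of File A's
assembled identity `galoisLogSum_katoUnitRep_even_of_le_span`:

* §1 `discr_eq_neg_seven` (`d_K = −7` from `[K:ℚ] = 2`, `s² = −7`; the tree's `Quadratic.discr_eq_of_sq_eq_intCast_of_neg`),
  `natAbs_discr_eq_seven`, `odd_discr`;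
* §2 THE CONDUCTOR IS `(√−7)·(D)`: `span_seven_eq_span_sqrt_sq` (`(7) = (s)²`), `absNorm_span_sqrt` (`N(s) = 7`),
  `eq_span_sqrt_of_seven_mem` (the only prime containing `7` is `(s)`), ★ `conductor_eq_span_sqrt_mul_span`
  (`N𝔣 = 7d²`, `𝔣 ∣ (7D)` ⟹ `𝔣 = (s)·(d)`), whence `conductor_le_span_d` (`𝔣 ⊆ (d)`) and `span_seven_mul_d_le_conductor`
  (`(7d) ⊆ 𝔣`) — the two hypotheses `h𝔣d`, `hpd𝔣` of File A;
* §3 `GenusFrame.isPrimitiveRoot_ζsys` and the ALIGNED ROOT `exists_alignedRoot` (`∃ ζₙ ∈ K(7^{n+1}𝔣)` primitive of order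
  `7^{n+1}d` with `e ζₙ = F.ζsys n`; memo S1, File A §2);
* §4 ★★ `galoisLogSum_even_of_pin` — THE KATO-SIDE LEVEL IDENTITY ON THE PIN DATA (memo S3): for every `n`, every
  primitive `7^{n+1}d`-th root `ζ ∈ K(7^{n+1}𝔣)`, every EVEN Dirichlet character `ψ ≠ 1` mod `7^{n+1}d` and every odd `Ψ` with
  `Ψ(k) = ψ(k)·(k/7)` (any level `M`),
  `Σ_{σ ∈ Gal(K(7^{n+1}𝔣)/K)} ψ(χ_cyc σ)·log‖ι̂(σ zₙ)‖ = −¼·(N𝔞 − ψ(N𝔞)⁻¹)·((Σ_{a mod M} a·Ψ(a))/M)·Σ_{b ∈ (ℤ/7^{n+1}d)ˣ} ψ(b) log‖1 − e^{2πib/7^{n+1}d}‖`,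
  CONDITIONAL on F5 `kato1551_kroneckerLimitFormula` (first binder) and nothing else; and `galoisLogSum_even_of_pin'` with
  `N𝔞` replaced by the frame's `F.normA`;
* §5 `galoisLogSum_normOver` — THE K-SIDE REGROUPING (memo S5 (a)), general: for `E = K(𝔪)`, any intermediate `M`, any
  character `χ` of `Gal(E/K)` trivial on the stabiliser `Gal(E/M)` and `z ≠ 0`,
  `Σ_σ χ(σ) log‖ι̂ σ N_{E/M}(z)‖ = #Gal(E/M) · Σ_σ χ(σ) log‖ι̂ σ z‖`;
* §6 (θN) `coe_family_eq_map_normOver` — the pin's stabiliser product is `e(N_{K(7^{n+1}𝔣)/Mₙ}(zₙ))`, `Mₙ = e⁻¹(F′ₙ)` (the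
  `hθN` block of p782533 as a named lemma), and `galoisLogSum_normOver_katoUnitRep` (§5 at the pin's representative).

HONEST LABEL: conditional theorems about the pin's own data; no new definition, no named fact, no instance; nothing closes;
stmt-BirchSwinnertonDyer-19945 OPEN; K1ᵘ NOT proved (S4–S9 of the memo are ahead); `X12.CMRamifiedSeven` NOT proved; BSD is
claimed for no curve; no summit statement is proved by this seat.

## References
* K. Kato, Astérisque 295 (2004) §15.5 (15.5.1) (p. 253), §15.8 (p. 257: `K` imaginary quadratic, `cond ψ`) [Kato2004Asterisque].
* J. Neukirch, *Algebraic Number Theory* (1999) I §8 (norms of ideals, prime decomposition in quadratic fields) [NeukirchANT1999].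
* D. A. Marcus, *Number Fields* (2018) Ch. 2 Thm. 1 (`d_K` of a quadratic field) [Marcus2018].
* Tree: File A (p786166), `RamifiedSevenGenusNormedFamilyFields.lean` (p782488), `RamifiedSevenGenusNumberFieldColumn.lean`,
  `QuadraticFields/DiscriminantOfSqrt.lean`; memo G45 S0–S3.
-/

noncomputable section

open scoped NumberField
open IsDedekindDomain NumberField
open Literature.NumberTheory.EllipticCurves (IsImaginaryQuadratic)
open Literature.NumberTheory.QuadraticFields (jacobiChar)
open Literature.NumberTheory.IwasawaTheory.CyclotomicUnits (cyclotomicLogSum)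
open Literature.NumberTheory.NumberFields (rayClassField)
open Literature.NumberTheory.ComplexMultiplication.EllipticUnits

namespace Summit.BirchSwinnertonDyer.Rank1Residual.Additive.GenusSeven

variable {K : Type} [Field K] [NumberField K]

/-! ## §1 The discriminant of the pin's CM field: `d_K = −7` -/

section Discr

/-- **`d_K = −7`** for `[K : ℚ] = 2` with `s² = −7` (`−7 ≡ 1 mod 4`, squarefree). [cite: Marcus2018, Ch. 2 Thm. 1] -/
theorem discr_eq_neg_seven (hK2 : Module.finrank ℚ K = 2) {s : K} (hs : s ^ 2 = -7) : NumberField.discr K = -7 := by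
  refine Literature.NumberTheory.QuadraticFields.Quadratic.discr_eq_of_sq_eq_intCast_of_neg hK2 (θ := s) (D := -7)
    (by rw [hs]; push_cast; ring) (by norm_num) (by decide) ?_
  rw [← Int.squarefree_natAbs]
  simpa using Nat.prime_seven.squarefree

/-- `|d_K| = 7`. [cite: Marcus2018, Ch. 2 Thm. 1] -/
theorem natAbs_discr_eq_seven (hK2 : Module.finrank ℚ K = 2) {s : K} (hs : s ^ 2 = -7) :
    (NumberField.discr K).natAbs = 7 := by
  rw [discr_eq_neg_seven hK2 hs]; rfl

/-- `d_K` is odd. [cite: Marcus2018, Ch. 2 Thm. 1] -/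
theorem odd_discr (hK2 : Module.finrank ℚ K = 2) {s : K} (hs : s ^ 2 = -7) : Odd (NumberField.discr K) := by
  rw [discr_eq_neg_seven hK2 hs]; decide

end Discr

/-! ## §2 The conductor pinned by `N𝔣 = 7d²`, `𝔣 ∣ (7D)` is `(√−7)·(D)` -/

section Conductor

omit [NumberField K] in
/-- `(7) = (s)²` in `O_K` for `s ∈ O_K`, `s² = −7`. [cite: NeukirchANT1999, Ch. I §8 (ramified prime of ℚ(√−7))] -/
theorem span_seven_eq_span_sqrt_sq (s : 𝓞 K) (hs : s ^ 2 = -7) :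
    Ideal.span {(7 : 𝓞 K)} = Ideal.span {s} ^ 2 := by
  rw [Ideal.span_singleton_pow, hs, Ideal.span_singleton_neg]

/-- `N((s)) = 7`. [cite: NeukirchANT1999, Ch. I §8] -/
theorem absNorm_span_sqrt (hK2 : Module.finrank ℚ K = 2) (s : 𝓞 K) (hs : s ^ 2 = -7) :
    Ideal.absNorm (Ideal.span {s}) = 7 := by
  rw [Ideal.absNorm_span_singleton, natAbs_norm_sqrt_negSeven hK2 s hs]

/-- `(s) ≠ 0`. [cite: NeukirchANT1999, Ch. I §8] -/
theorem span_sqrt_ne_bot (hK2 : Module.finrank ℚ K = 2) (s : 𝓞 K) (hs : s ^ 2 = -7) : Ideal.span {s} ≠ ⊥ := by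
  intro h
  have h7 := absNorm_span_sqrt hK2 s hs
  rw [h, Ideal.absNorm_bot] at h7
  exact absurd h7 (by norm_num)

/-- `(s)` is a prime ideal (its norm `7` is prime). [cite: NeukirchANT1999, Ch. I §8] -/
theorem isPrime_span_sqrt (hK2 : Module.finrank ℚ K = 2) (s : 𝓞 K) (hs : s ^ 2 = -7) : (Ideal.span {s}).IsPrime :=
  Ideal.isPrime_of_irreducible_absNorm (by rw [absNorm_span_sqrt hK2 s hs]; exact Nat.prime_seven)

/-- **The only prime of `O_K` containing `7` is `(s)`** (`7` is totally ramified in `ℚ(√−7)`: `s² = −7 ∈ 𝔮 ⇒ s ∈ 𝔮`, and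
`(s)` is maximal). [cite: NeukirchANT1999, Ch. I §8 (decomposition of 7 in ℚ(√−7))] -/
theorem eq_span_sqrt_of_seven_mem (hK2 : Module.finrank ℚ K = 2) (s : 𝓞 K) (hs : s ^ 2 = -7) {𝔮 : Ideal (𝓞 K)}
    (h𝔮 : 𝔮.IsPrime) (h7 : (7 : 𝓞 K) ∈ 𝔮) : 𝔮 = Ideal.span {s} := by
  have hs𝔮 : s ∈ 𝔮 := by
    refine h𝔮.mem_of_pow_mem 2 ?_
    rw [hs]; exact 𝔮.neg_mem_iff.mpr h7
  have hle : Ideal.span {s} ≤ 𝔮 := (Ideal.span_singleton_le_iff_mem _).mpr hs𝔮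
  exact (((isPrime_span_sqrt hK2 s hs).isMaximal (span_sqrt_ne_bot hK2 s hs)).eq_of_le h𝔮.ne_top hle).symm

omit [NumberField K] in
/-- `(D) = (|D|)` in `O_K` for an integer `D` (= `CubicSieve.span_intCast_eq_span_natAbs` of
`Sieve/HeathBrownCubicLemma51.lean`, re-proved privately rather than importing the cubic-sieve file). [cite: NeukirchANT1999, Ch. I §3 (unit ±1)] -/
private theorem span_intCast_eq_span_natAbs (D : ℤ) : Ideal.span {(D : 𝓞 K)} = Ideal.span {((D.natAbs : ℕ) : 𝓞 K)} := by
  rcases Int.natAbs_eq D with h | h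
  · conv_lhs => rw [h]
    rw [Int.cast_natCast]
  · conv_lhs => rw [h]
    rw [Int.cast_neg, Int.cast_natCast, Ideal.span_singleton_neg]

/-- ★ **THE PINNED CONDUCTOR IS `(√−7)·(|D|)`**: `[K : ℚ] = 2`, `s² = −7`, `N𝔣 = 7·|D|²`, `𝔣 ∣ (7D)`, `D ≠ 0` ⟹
`𝔣 = (s)·(|D|)` (the cofactor `𝔤` of `𝔣` in `(7D) = (s)²(|D|)` has norm `49|D|²/(7|D|²) = 7`, so it is a prime containing `7`,
i.e. `(s)`; cancel `(s)`). [cite: Kato2004Asterisque, §15.8 (p. 257, «𝔣 = cond ψ»)] [cite: NeukirchANT1999, Ch. I §8] -/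
theorem conductor_eq_span_sqrt_mul_span (hK2 : Module.finrank ℚ K = 2) (s : 𝓞 K) (hs : s ^ 2 = -7) {D : ℤ} (hD : D ≠ 0)
    {𝔣 : Ideal (𝓞 K)} (hN𝔣 : Ideal.absNorm 𝔣 = 7 * D.natAbs ^ 2) (h𝔣D : 𝔣 ∣ Ideal.span {((7 * D : ℤ) : 𝓞 K)}) :
    𝔣 = Ideal.span {s} * Ideal.span {((D.natAbs : ℕ) : 𝓞 K)} := by
  have hfact : Ideal.span {((7 * D : ℤ) : 𝓞 K)} = Ideal.span {s} ^ 2 * Ideal.span {((D.natAbs : ℕ) : 𝓞 K)} := by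
    rw [Int.cast_mul, ← Ideal.span_singleton_mul_span_singleton, Int.cast_ofNat, span_seven_eq_span_sqrt_sq s hs,
      span_intCast_eq_span_natAbs]
  obtain ⟨𝔤, h𝔤⟩ := h𝔣D
  have hd0 : D.natAbs ≠ 0 := Int.natAbs_ne_zero.mpr hD
  -- norms: `49·|D|² = 7|D|²·N𝔤`
  have hN : Ideal.absNorm 𝔤 = 7 := by
    have h1 := congrArg Ideal.absNorm h𝔤
    rw [hfact, map_mul, map_mul, map_pow, absNorm_span_sqrt hK2 s hs, absNorm_span_natCast hK2, hN𝔣] at h1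
    have h2 : 7 * D.natAbs ^ 2 * Ideal.absNorm 𝔤 = 7 * D.natAbs ^ 2 * 7 := by rw [← h1]; ring
    exact Nat.eq_of_mul_eq_mul_left (Nat.mul_pos (by norm_num) (pow_pos (Nat.pos_of_ne_zero hd0) 2)) h2
  -- so `𝔤` is a prime containing `7`, i.e. `(s)`
  have h𝔤p : 𝔤.IsPrime := Ideal.isPrime_of_irreducible_absNorm (by rw [hN]; exact Nat.prime_seven)
  have h7 : (7 : 𝓞 K) ∈ 𝔤 := by
    have := Ideal.absNorm_mem 𝔤
    rwa [hN, Nat.cast_ofNat] at this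
  have h𝔤s : 𝔤 = Ideal.span {s} := eq_span_sqrt_of_seven_mem hK2 s hs h𝔤p h7
  -- cancel `(s)` in `𝔣·(s) = (s)²·(|D|)`
  rw [h𝔤s, hfact, sq, mul_assoc, mul_comm] at h𝔤
  exact (mul_right_cancel₀ (span_sqrt_ne_bot hK2 s hs) h𝔤.symm)

/-- **`𝔣 ⊆ (|D|)`** (hypothesis `h𝔣d` of File A). [cite: Kato2004Asterisque, §15.8 (p. 257)] -/
theorem conductor_le_span_d (hK2 : Module.finrank ℚ K = 2) {x : K} (hx : x ^ 2 = -7) {D : ℤ} (hD : D ≠ 0)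
    {𝔣 : Ideal (𝓞 K)} (hN𝔣 : Ideal.absNorm 𝔣 = 7 * D.natAbs ^ 2) (h𝔣D : 𝔣 ∣ Ideal.span {((7 * D : ℤ) : 𝓞 K)}) :
    𝔣 ≤ Ideal.span {((D.natAbs : ℕ) : 𝓞 K)} := by
  obtain ⟨s, -, hs⟩ := exists_ringOfIntegers_sqrt x hx
  rw [conductor_eq_span_sqrt_mul_span hK2 s hs hD hN𝔣 h𝔣D]
  exact Ideal.mul_le_left

/-- **`(7·|D|) ⊆ 𝔣`** (hypothesis `hpd𝔣` of File A; `(7|D|) = (s)²(|D|) ⊆ (s)(|D|)`). [cite: Kato2004Asterisque, §15.8 (p. 257)] -/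
theorem span_seven_mul_d_le_conductor (hK2 : Module.finrank ℚ K = 2) {x : K} (hx : x ^ 2 = -7) {D : ℤ} (hD : D ≠ 0)
    {𝔣 : Ideal (𝓞 K)} (hN𝔣 : Ideal.absNorm 𝔣 = 7 * D.natAbs ^ 2) (h𝔣D : 𝔣 ∣ Ideal.span {((7 * D : ℤ) : 𝓞 K)}) :
    Ideal.span {((7 * D.natAbs : ℕ) : 𝓞 K)} ≤ 𝔣 := by
  obtain ⟨s, -, hs⟩ := exists_ringOfIntegers_sqrt x hx
  rw [conductor_eq_span_sqrt_mul_span hK2 s hs hD hN𝔣 h𝔣D, Nat.cast_mul, ← Ideal.span_singleton_mul_span_singleton,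
    Nat.cast_ofNat, span_seven_eq_span_sqrt_sq s hs, sq, mul_assoc]
  exact Ideal.mul_le_left

/-- `𝔣 ≠ 0` (its norm is `7d² ≠ 0`). [cite: Kato2004Asterisque, §15.5 (p. 253)] -/
theorem conductor_ne_bot {D : ℤ} (hD : D ≠ 0) {𝔣 : Ideal (𝓞 K)} (hN𝔣 : Ideal.absNorm 𝔣 = 7 * D.natAbs ^ 2) : 𝔣 ≠ ⊥ := by
  intro h
  rw [h, Ideal.absNorm_bot] at hN𝔣
  exact absurd hN𝔣.symm (Nat.mul_ne_zero (by norm_num) (pow_ne_zero 2 (Int.natAbs_ne_zero.mpr hD)))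

end Conductor

/-! ## §3 The frame's roots of unity and the aligned root `ζₙ ∈ K(7^{n+1}𝔣)` with `e ζₙ = ζsys n` -/

/-- `ζsys n` is a primitive `7^{n+1}|D|`-th root of unity. [cite: Tsuji1999, §6 (p. 20, the compatible system)] -/
theorem GenusFrame.isPrimitiveRoot_ζsys (F : GenusFrame) (n : ℕ) : IsPrimitiveRoot (F.ζsys n) (7 ^ (n + 1) * F.d) :=
  F.ζsys_compatible.1 n

/-- **THE ALIGNED ROOT** (memo S1): for the pin's `K` (`s² = −7`, so `K` is totally complex), `𝔣` (`N𝔣 = 7d²`, `𝔣 ∣ (7D)`)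
and `e : K̄ → ℚ̄`, at every level `n` there is a primitive `7^{n+1}|D|`-th root of unity `ζₙ ∈ K(7^{n+1}𝔣)` with
`e ζₙ = F.ζsys n` — File A's `exists_isPrimitiveRoot_katoLayer_map_eq` with its hypotheses discharged from the pin.
[cite: NeukirchANT1999, Ch. VI §6 Prop. (6.7) (proof) p. 399] -/
theorem exists_alignedRoot (F : GenusFrame) (hK2 : Module.finrank ℚ K = 2) {x : K} (hx : x ^ 2 = -7)
    (e : AlgebraicClosure K →+* AlgebraicClosure ℚ) {𝔣 : Ideal (𝓞 K)} (hN𝔣 : Ideal.absNorm 𝔣 = 7 * F.d ^ 2)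
    (h𝔣D : 𝔣 ∣ Ideal.span {((7 * F.D : ℤ) : 𝓞 K)}) (n : ℕ) :
    ∃ ζ : katoLayer 7 𝔣 (n + 1), IsPrimitiveRoot ζ (7 ^ (n + 1) * F.d) ∧ e (ζ : AlgebraicClosure K) = F.ζsys n := by
  haveI : Fact (Nat.Prime 7) := ⟨Nat.prime_seven⟩
  haveI : IsTotallyComplex K := isTotallyComplex_of_sq_eq_neg_seven hx
  haveI : NeZero (7 ^ (n + 1) * F.d) := ⟨Nat.mul_ne_zero (pow_ne_zero _ (by norm_num)) F.d_ne_zero⟩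
  have _ := hK2
  exact exists_isPrimitiveRoot_katoLayer_map_eq (conductor_ne_bot F.D_neg.ne hN𝔣)
    (conductor_le_span_d hK2 hx F.D_neg.ne hN𝔣 h𝔣D) n e (F.isPrimitiveRoot_ζsys n)

/-! ## §4 Kronecker's limit formula at the genus characters, ON THE PIN DATA (memo S3) -/

/-- `jacobiChar` only depends on the level (transport along `N = N'`). [cite: Cox2013, §1.C Lemma 1.14] -/
theorem jacobiChar_congr {N N' : ℕ} [NeZero N] [NeZero N'] (h : N = N') (k : ℕ) : jacobiChar N k = jacobiChar N' k := by
  subst h; rfl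

/-- ★★ **THE KATO-SIDE LEVEL-`n` IDENTITY ON THE PIN DATA** (memo S3 with every side condition discharged from the pins of
`IsNormedEllipticUnitFamily`): `[K : ℚ] = 2`, `x² = −7` in `K`, `ι : K → ℂ`, `N𝔣 = 7d²`, `𝔣 ∣ (7D)`, `𝔞` an admissible
twist, `u` a level-`(n+1)` representative of `_𝔞z_{7^{n+1}𝔣}`, `ζ ∈ K(7^{n+1}𝔣)` a primitive `7^{n+1}|D|`-th root of unity,
`ψ` an EVEN Dirichlet character `≠ 1` mod `7^{n+1}|D|`, `Ψ` odd with `Ψ(k) = ψ(k)·(k/7)`: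
`Σ_{σ ∈ Gal(K(7^{n+1}𝔣)/K)} ψ(χ_cyc σ) log‖ι̂ σu‖ = −¼·(N𝔞 − ψ(N𝔞)⁻¹)·((Σ_{a mod M} a·Ψ(a))/M)·cyclotomicLogSum ψ`.
CONDITIONAL on F5 only. [cite: Kato2004Asterisque, §15.5 (15.5.1) (p. 253)] [cite: Lang1990, Ch. 3 §5 (PDF pp. 70–72)] -/
theorem galoisLogSum_even_of_pin (hF5 : Kato2004.kato1551_kroneckerLimitFormula) (hK2 : Module.finrank ℚ K = 2) {x : K}
    (hx : x ^ 2 = -7) (ι : K →+* ℂ) {D : ℤ} (hD : D ≠ 0) {𝔣 𝔞 : Ideal (𝓞 K)}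
    (hN𝔣 : Ideal.absNorm 𝔣 = 7 * D.natAbs ^ 2) (h𝔣D : 𝔣 ∣ Ideal.span {((7 * D : ℤ) : 𝓞 K)})
    [Fact (Nat.Prime 7)] (h𝔞 : IsTwist 7 𝔣 𝔞) {n : ℕ} {u : (AlgebraicClosure K)ˣ} (hu : IsKatoUnitRep 7 ι 𝔣 (n + 1) 𝔞 u)
    [NeZero (7 ^ (n + 1) * D.natAbs)] {ζ : katoLayer 7 𝔣 (n + 1)} (hζ : IsPrimitiveRoot ζ (7 ^ (n + 1) * D.natAbs))
    (ψ : DirichletCharacter ℂ (7 ^ (n + 1) * D.natAbs)) (hψe : ψ.Even) (hψ1 : ψ ≠ 1)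
    {M : ℕ} [NeZero M] (Ψ : DirichletCharacter ℂ M) (hΨ : ∀ k : ℕ, Ψ k = ψ k * jacobiChar 7 k) (hΨo : Ψ.Odd) :
    galoisLogSum (katoModulus 7 𝔣 (n + 1)) (ψ.toUnitHom.comp (hζ.autToPow K)) (algClosureEmb ι) ⟨u, hu.isKatoUnit.2⟩ =
      -(1 / 4) * (((Ideal.absNorm 𝔞 : ℕ) : ℂ) - (ψ (Ideal.absNorm 𝔞))⁻¹) *
        ((∑ a : ZMod M, (a.val : ℂ) * Ψ a) / M) * cyclotomicLogSum ψ := by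
  have hΨ' : ∀ k : ℕ, Ψ k = ψ k * jacobiChar (NumberField.discr K).natAbs k := fun k => by
    rw [hΨ k, jacobiChar_congr (natAbs_discr_eq_seven hK2 hx).symm k]
  exact galoisLogSum_katoUnitRep_even_of_le_span hF5 (isImaginaryQuadratic_of_sq hK2 hx) (odd_discr hK2 hx) ι
    (conductor_ne_bot hD hN𝔣) (conductor_le_span_d hK2 hx hD hN𝔣 h𝔣D) (span_seven_mul_d_le_conductor hK2 hx hD hN𝔣 h𝔣D)
    (unitsInjectiveMod_katoModulus hK2 hx hN𝔣 (n + 1)) h𝔞 hu hζ ψ hψe hψ1 Ψ hΨ' hΨo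

/-- ★★′ **The same in the frame's letters** (`D = F.D`, `d = F.d`, `N𝔞 = F.normA` from the pin `absNorm 𝔞 = F.normA`).
CONDITIONAL on F5 only. [cite: Kato2004Asterisque, §15.5 (15.5.1) (p. 253)] [cite: Lang1990, Ch. 3 §5 (PDF pp. 70–72)] -/
theorem galoisLogSum_even_of_pin' (hF5 : Kato2004.kato1551_kroneckerLimitFormula) (F : GenusFrame) (hK2 : Module.finrank ℚ K = 2)
    {x : K} (hx : x ^ 2 = -7) (ι : K →+* ℂ) {𝔣 𝔞 : Ideal (𝓞 K)}
    (hN𝔣 : Ideal.absNorm 𝔣 = 7 * F.d ^ 2) (h𝔣D : 𝔣 ∣ Ideal.span {((7 * F.D : ℤ) : 𝓞 K)})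
    [Fact (Nat.Prime 7)] (h𝔞 : IsTwist 7 𝔣 𝔞) (hN𝔞 : Ideal.absNorm 𝔞 = F.normA)
    {n : ℕ} {u : (AlgebraicClosure K)ˣ} (hu : IsKatoUnitRep 7 ι 𝔣 (n + 1) 𝔞 u)
    [NeZero (7 ^ (n + 1) * F.d)] {ζ : katoLayer 7 𝔣 (n + 1)} (hζ : IsPrimitiveRoot ζ (7 ^ (n + 1) * F.d))
    (ψ : DirichletCharacter ℂ (7 ^ (n + 1) * F.d)) (hψe : ψ.Even) (hψ1 : ψ ≠ 1)
    {M : ℕ} [NeZero M] (Ψ : DirichletCharacter ℂ M) (hΨ : ∀ k : ℕ, Ψ k = ψ k * jacobiChar 7 k) (hΨo : Ψ.Odd) :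
    galoisLogSum (katoModulus 7 𝔣 (n + 1)) (ψ.toUnitHom.comp (hζ.autToPow K)) (algClosureEmb ι) ⟨u, hu.isKatoUnit.2⟩ =
      -(1 / 4) * ((F.normA : ℂ) - (ψ F.normA)⁻¹) *
        ((∑ a : ZMod M, (a.val : ℂ) * Ψ a) / M) * cyclotomicLogSum ψ := by
  rw [← hN𝔞]
  exact galoisLogSum_even_of_pin hF5 hK2 hx ι F.D_neg.ne hN𝔣 h𝔣D h𝔞 hu hζ ψ hψe hψ1 Ψ hΨ hΨo

/-! ## §5 Regrouping `Σ_σ χ(σ) log‖ι̂ σ·‖` along a relative norm (memo S5 (a), the K-side move) -/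

section Regroup

/-- **`Σ_σ χ(σ)·log‖ι̂(σ N_{E/M} z)‖ = #Gal(E/M) · Σ_σ χ(σ)·log‖ι̂(σ z)‖`** for `E = K(𝔪)`, any intermediate `M`, any character
`χ` of `Gal(E/K)` TRIVIAL on the stabiliser `{ρ | ρ|_M = id}` and any `z ≠ 0`: `log‖ι̂ σ(∏_ρ ρz)‖ = Σ_ρ log‖ι̂ (σρ) z‖`, and
`σ ↦ σρ` permutes `Gal(E/K)` with `χ(σρ) = χ(σ)`.  (The general regrouping behind «`θ_n = N_{K(𝔪ₙ)/Mₙ}(zₙ)` carries F5 to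
`Gal(Mₙ/K)`», memo S5 (a); no hypothesis on `M`.) [cite: Kato2004Asterisque, §15.5 (p. 253, «the norm map … sends _𝔞z to _𝔞z»)]
[cite: deShalit1987, II.2.5 Proposition (i) (norm relations)] -/
theorem galoisLogSum_normOver {𝔪 : Ideal (𝓞 K)} (M : IntermediateField K (AlgebraicClosure K))
    (χ : (rayClassField K 𝔪 ≃ₐ[K] rayClassField K 𝔪) →* ℂˣ) (hχ : ∀ ρ ∈ galOver (rayClassField K 𝔪) M, χ ρ = 1)
    (ι : AlgebraicClosure K →+* ℂ) {z : rayClassField K 𝔪} (hz : z ≠ 0) :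
    galoisLogSum 𝔪 χ ι (normOver (rayClassField K 𝔪) M z) =
      (Nat.card (galOver (rayClassField K 𝔪) M) : ℂ) * galoisLogSum 𝔪 χ ι z := by
  classical
  have hfin : (galOver (rayClassField K 𝔪) M).Finite := Set.toFinite _
  have hN : normOver (rayClassField K 𝔪) M z = ∏ ρ ∈ hfin.toFinset, ρ z := by
    rw [normOver, finprod_mem_eq_finite_toFinset_prod _ hfin]
  have hcard : (Nat.card (galOver (rayClassField K 𝔪) M) : ℂ) = (hfin.toFinset.card : ℂ) := by
    rw [Nat.card_coe_set_eq, Set.ncard_eq_toFinset_card _ hfin]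
  have hne : ∀ τ : rayClassField K 𝔪 ≃ₐ[K] rayClassField K 𝔪,
      ι ((τ z : rayClassField K 𝔪) : AlgebraicClosure K) ≠ 0 := fun τ => by
    rw [map_ne_zero ι, ne_eq, ZeroMemClass.coe_eq_zero]
    exact (map_ne_zero τ).mpr hz
  have hlog : ∀ σ : rayClassField K 𝔪 ≃ₐ[K] rayClassField K 𝔪,
      (Real.log ‖ι ((σ (normOver (rayClassField K 𝔪) M z) : rayClassField K 𝔪) : AlgebraicClosure K)‖ : ℂ) =
        ∑ ρ ∈ hfin.toFinset, (Real.log ‖ι ((σ (ρ z) : rayClassField K 𝔪) : AlgebraicClosure K)‖ : ℂ) := by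
    intro σ
    rw [hN, map_prod σ, SubmonoidClass.coe_finsetProd, map_prod ι, norm_prod,
      Real.log_prod (fun ρ _ => norm_ne_zero_iff.mpr ?_), Complex.ofReal_sum]
    rw [← AlgEquiv.mul_apply]
    exact hne (σ * ρ)
  simp only [galoisLogSum, finsum_eq_sum_of_fintype, hlog, Finset.mul_sum]
  rw [Finset.sum_comm]
  have hinner : ∀ ρ ∈ hfin.toFinset, ∑ σ : rayClassField K 𝔪 ≃ₐ[K] rayClassField K 𝔪,
      ((χ σ : ℂˣ) : ℂ) * (Real.log ‖ι ((σ (ρ z) : rayClassField K 𝔪) : AlgebraicClosure K)‖ : ℂ) =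
        ∑ σ : rayClassField K 𝔪 ≃ₐ[K] rayClassField K 𝔪,
          ((χ σ : ℂˣ) : ℂ) * (Real.log ‖ι ((σ z : rayClassField K 𝔪) : AlgebraicClosure K)‖ : ℂ) := by
    intro ρ hρ
    have hρ1 : χ ρ = 1 := hχ ρ (hfin.mem_toFinset.mp hρ)
    exact Fintype.sum_equiv (Equiv.mulRight ρ) _ _ (fun σ => by
      simp only [Equiv.coe_mulRight, map_mul, hρ1, mul_one, AlgEquiv.mul_apply])
  rw [Finset.sum_congr rfl hinner, Finset.sum_const, nsmul_eq_mul, hcard, Finset.mul_sum]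

end Regroup

/-! ## §6 (θN): the pinned family is the norm of Kato's representative to `Mₙ = e⁻¹(F′ₙ)` (re-extracted from p782533) -/

/-- **(θN) `θu n = e(N_{K(7^{n+1}𝔣)/Mₙ}(zₙ))`**, `Mₙ = e⁻¹(F′ₙ)`: the pin's stabiliser product IS the relative norm `normOver`
to the preimage field (the twelve lines `hθN` inside `GenusFrame.isGlobalNormCoherent_pow_twelve_of_pin`, now a named lemma;
memo S0/S5 (a)). [cite: Kato2004Asterisque, §15.5 (p. 253, «_𝔞z_𝔣 ∈ K(𝔣)^×») and §15.14 (p. 264, «F′_n ⊂ K(7^{n+1}𝔣)»)]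
[cite: deShalit1987, II.2.4 Proposition and II.2.5 (norm relations of the elliptic units)] -/
theorem coe_family_eq_map_normOver (F : GenusFrame) {θu : ∀ n : ℕ, globalUnitsOf (F.layer n)}
    (hK2 : Module.finrank ℚ K = 2) {x : K} (hx : x ^ 2 = -7) (e : AlgebraicClosure K →+* AlgebraicClosure ℚ)
    {ι : K →+* ℂ} {𝔣 𝔞 : Ideal (𝓞 K)} {z : ℕ → (AlgebraicClosure K)ˣ} (hz : ∀ n : ℕ, IsKatoUnitRep 7 ι 𝔣 (n + 1) 𝔞 (z n))
    (hθ : ∀ n : ℕ, (((θu n : globalUnitsOf (F.layer n)) : (AlgebraicClosure ℚ)ˣ) : AlgebraicClosure ℚ) =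
      ∏ᶠ τ ∈ {τ : katoLayer 7 𝔣 (n + 1) ≃ₐ[K] katoLayer 7 𝔣 (n + 1) |
          ∀ y : katoLayer 7 𝔣 (n + 1), e (y : AlgebraicClosure K) ∈ F.layer n → τ y = y},
        e ((τ ⟨((z n : (AlgebraicClosure K)ˣ) : AlgebraicClosure K), (hz n).1.1⟩ : katoLayer 7 𝔣 (n + 1)) :
          AlgebraicClosure K))
    (n : ℕ) :
    (((θu n : globalUnitsOf (F.layer n)) : (AlgebraicClosure ℚ)ˣ) : AlgebraicClosure ℚ) =
      e ((normOver (katoLayer 7 𝔣 (n + 1))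
          (preimageField e (F.layer n) (fun k => GenusFrame.apply_algebraMap_mem_layer hK2 hx e n k))
          ⟨(z n : AlgebraicClosure K), (hz n).1.1⟩ : katoLayer 7 𝔣 (n + 1)) : AlgebraicClosure K) := by
  rw [hθ n, normOver, galOver_preimageField]
  have hfin : ({τ : katoLayer 7 𝔣 (n + 1) ≃ₐ[K] katoLayer 7 𝔣 (n + 1) |
      ∀ y : katoLayer 7 𝔣 (n + 1), e (y : AlgebraicClosure K) ∈ F.layer n → τ y = y}).Finite := Set.toFinite _
  exact (MonoidHom.map_finprod_mem
    (fun σ : katoLayer 7 𝔣 (n + 1) ≃ₐ[K] katoLayer 7 𝔣 (n + 1) =>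
      σ (⟨(z n : AlgebraicClosure K), (hz n).1.1⟩ : katoLayer 7 𝔣 (n + 1)))
    (e.toMonoidHom.comp ((algebraMap (katoLayer 7 𝔣 (n + 1)) (AlgebraicClosure K)).toMonoidHom)) hfin).symm

/-- **(θN) ∘ §5: F5's sum for the NORMED unit** — `Σ_σ χ(σ) log‖ι̂ σ N_{K(𝔪ₙ)/Mₙ}(zₙ)‖ = #Stabₙ · Σ_σ χ(σ) log‖ι̂ σ zₙ‖` for
every character `χ` of `Gal(K(7^{n+1}𝔣)/K)` trivial on the stabiliser `Stabₙ = Gal(K(7^{n+1}𝔣)/Mₙ)` of `Mₙ = e⁻¹(F′ₙ)`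
(`zₙ ≠ 0`: a unit).  Memo S5 (a), K-side, on the pin data. [cite: Kato2004Asterisque, §15.5 (15.5.1) (p. 253)] -/
theorem galoisLogSum_normOver_katoUnitRep (F : GenusFrame) (hK2 : Module.finrank ℚ K = 2) {x : K} (hx : x ^ 2 = -7)
    (e : AlgebraicClosure K →+* AlgebraicClosure ℚ) {ι : K →+* ℂ} {𝔣 𝔞 : Ideal (𝓞 K)} {n : ℕ}
    {u : (AlgebraicClosure K)ˣ} (hu : IsKatoUnitRep 7 ι 𝔣 (n + 1) 𝔞 u)
    (χ : (katoLayer 7 𝔣 (n + 1) ≃ₐ[K] katoLayer 7 𝔣 (n + 1)) →* ℂˣ)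
    (hχ : ∀ ρ ∈ galOver (katoLayer 7 𝔣 (n + 1))
      (preimageField e (F.layer n) (fun k => GenusFrame.apply_algebraMap_mem_layer hK2 hx e n k)), χ ρ = 1) :
    galoisLogSum (katoModulus 7 𝔣 (n + 1)) χ (algClosureEmb ι)
        (normOver (katoLayer 7 𝔣 (n + 1))
          (preimageField e (F.layer n) (fun k => GenusFrame.apply_algebraMap_mem_layer hK2 hx e n k)) ⟨u, hu.isKatoUnit.2⟩) =
      (Nat.card (galOver (katoLayer 7 𝔣 (n + 1))
          (preimageField e (F.layer n) (fun k => GenusFrame.apply_algebraMap_mem_layer hK2 hx e n k))) : ℂ) *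
        galoisLogSum (katoModulus 7 𝔣 (n + 1)) χ (algClosureEmb ι) ⟨u, hu.isKatoUnit.2⟩ :=
  galoisLogSum_normOver _ χ hχ (algClosureEmb ι) (by
    rw [ne_eq, ← ZeroMemClass.coe_eq_zero]
    exact u.ne_zero)

end Summit.BirchSwinnertonDyer.Rank1Residual.Additive.GenusSeven

end
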